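import Mathlib
import Summits.Ventures.PercRepro2.PMK5Deg5LocusIff
import Summits.Ventures.PercRepro2.BlockSubstLaw

/-!
# THEOREM 31 on every graph with at most six terminals: the equality locus of (HCOV) is the
five-class locus of the skeleton (blind cell PercRepro2, mine-2 g33)

For a block substitution of `K₆` (`IsBlockSubst ends Deg5.ends15 q blk Vj`, the marks at the
terminals `q 0, q 1, q 2, q 5, q 4`) the covariance form is the form of `K₆` at the block weights
(`Gc_blockSubst`), so THEOREM 31 (`Deg5.Locus.gc15_pos_iff` / `gc15_zero_iff`: the lead's five
exact-zero classes of Theorem 8.1 on all `2¹⁵` edge sets of `K₆`) reads the locus off the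
SKELETON MASK `M` — the set of blocks that can connect their terminals — provided no block is
surely connected (`bsProb < 1` on `M`):

* **`gc_sixTerminal_pos_iff`**: `0 < Gc` iff `K₆(M)` is in none of the five classes;
* **`gc_sixTerminal_zero_iff`**: `Gc = 0` iff `K₆(M)` is in one of them (`FiveClass15 M = true`,
  = the five connectivity conditions on `K₆(M)` by `Deg5.Locus.fiveClass15_iff`);
* the one-directional forms `gc_sixTerminal_pos_of_face` / `gc_sixTerminal_zero_of_face` (the
  zero side needs no interior hypothesis).

A block of weight exactly `1` is a contracted skeleton edge and is not covered here (Theorem 31 is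
stated on the open faces of the cube).  Standard axioms only.

(v2: the declarations of the accepted v1 byte for byte; re-filed because the farm served no olean
of v1 for 15 minutes while later landings were served — the second such loss on this lane today.)
-/

namespace Summit.Ventures.PercRepro2

namespace BlockSubst

section Locus

open Deg5 Deg5.Locus

variable {V : Type*} {E : Type*} [Fintype E] [DecidableEq E] {R : Type*} [Field R]
  [LinearOrder R] [IsStrictOrderedRing R]
variable {ends : E → Sym2 V} {q : Fin 6 → V} {blk : E → Fin 15} {Vj : Fin 15 → Set V}

/-- **The zero side**: if the blocks outside the skeleton mask `M` cannot connect their terminals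
and `K₆(M)` is in one of the five classes, the covariance form of the graph vanishes. -/
theorem gc_sixTerminal_zero_of_face (hB : IsBlockSubst ends ends15 q blk Vj) (p : E → R) (M : ℕ)
    (hM : M < 32768) (hr : FiveClass15 M = true)
    (hp₀ : ∀ j : Fin 15, M.testBit j = false → bsProb ends ends15 q blk p j = 0) :
    CovForm.Gc p ends (q 0) (q 1) (q 2) (q 5) (q 4) = 0 := by
  rw [Gc_blockSubst hB p 0 1 2 5 4]
  exact gc15_zero_of_face M hM hr _ hp₀

/-- **The positive side**: if the blocks of the skeleton mask `M` connect their terminals with a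
probability strictly between `0` and `1`, the other blocks never, and `K₆(M)` is in none of the
five classes, the covariance form of the graph is strictly positive. -/
theorem gc_sixTerminal_pos_of_face (hB : IsBlockSubst ends ends15 q blk Vj) (p : E → R) (M : ℕ)
    (hM : M < 32768) (hr : FiveClass15 M = false)
    (hp₁ : ∀ j : Fin 15, M.testBit j = true →
      0 < bsProb ends ends15 q blk p j ∧ bsProb ends ends15 q blk p j < 1)
    (hp₀ : ∀ j : Fin 15, M.testBit j = false → bsProb ends ends15 q blk p j = 0) :
    0 < CovForm.Gc p ends (q 0) (q 1) (q 2) (q 5) (q 4) := by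
  rw [Gc_blockSubst hB p 0 1 2 5 4]
  exact gc15_pos_of_face M hM hr _ hp₁ hp₀

/-- **THEOREM 31 on every graph with at most six terminals, positive side**: with `M` the skeleton
mask (the blocks of `M` connect their terminals with probability in `(0, 1)`, the others never),
`0 < Gc` iff `K₆(M)` is in none of the five classes. -/
theorem gc_sixTerminal_pos_iff (hB : IsBlockSubst ends ends15 q blk Vj) (p : E → R) (M : ℕ)
    (hM : M < 32768)
    (hp₁ : ∀ j : Fin 15, M.testBit j = true →
      0 < bsProb ends ends15 q blk p j ∧ bsProb ends ends15 q blk p j < 1)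
    (hp₀ : ∀ j : Fin 15, M.testBit j = false → bsProb ends ends15 q blk p j = 0) :
    0 < CovForm.Gc p ends (q 0) (q 1) (q 2) (q 5) (q 4) ↔ FiveClass15 M = false := by
  constructor
  · intro h
    by_contra hF
    rw [Bool.not_eq_false] at hF
    rw [gc_sixTerminal_zero_of_face hB p M hM hF hp₀] at h
    exact lt_irrefl _ h
  · intro hr
    exact gc_sixTerminal_pos_of_face hB p M hM hr hp₁ hp₀

/-- **THEOREM 31 on every graph with at most six terminals, zero side**: with `M` the skeleton
mask as above, `Gc = 0` iff `K₆(M)` is in one of the five classes. -/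
theorem gc_sixTerminal_zero_iff (hB : IsBlockSubst ends ends15 q blk Vj) (p : E → R) (M : ℕ)
    (hM : M < 32768)
    (hp₁ : ∀ j : Fin 15, M.testBit j = true →
      0 < bsProb ends ends15 q blk p j ∧ bsProb ends ends15 q blk p j < 1)
    (hp₀ : ∀ j : Fin 15, M.testBit j = false → bsProb ends ends15 q blk p j = 0) :
    CovForm.Gc p ends (q 0) (q 1) (q 2) (q 5) (q 4) = 0 ↔ FiveClass15 M = true := by
  constructor
  · intro h
    by_contra hF
    rw [Bool.not_eq_true] at hF
    have := gc_sixTerminal_pos_of_face hB p M hM hF hp₁ hp₀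
    rw [h] at this
    exact lt_irrefl _ this
  · intro hr
    exact gc_sixTerminal_zero_of_face hB p M hM hr hp₀

end Locus

end BlockSubst

end Summit.Ventures.PercRepro2
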